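import Summits.QuantumFields.BalabanUV.T4Continuum.Spine.NE1p.DressedTransportAssembledFinalForm
import Summits.QuantumFields.BalabanUV.T4Continuum.Spine.NE1p.DressedTransportRatioScheduled

/-!
# T⁴ programme, spine estimate NE1′ (node O3b/H2) — THE K-FREE PER-CUTOFF FACE OVER CANONICAL DATA: FINAL-FORM END ∘ WINDOW
# SCHEDULE ∘ ROW S3 (swarm row S3f (N23e′) «canonical re-base» of `t4/formal/NE1p/LEAVES.md` v2.3)

Cell `pub-balaban`, sub-cell `t4`, BINDER-OWNERS row NE1′, formalisation crew `b2b-balaban-t4-ne1p-formalise-*`, seat `…-leaf-03`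
(generation 2; `CLAIM NE1p-S3f` in HOME/CLAIMS.log).  ADDITIVE — imports `Spine/NE1p/DressedTransportAssembledFinalForm` (row S2d,
leaf-01: the final-form END `transportLeaf_assembled_canonical_ratio`, p213340) and `Spine/NE1p/DressedTransportRatioScheduled`
(row S3d, leaf-09: `bookingLeaves_ratio_of_schedule`, `ratio_κ_nonneg`; through it rows S1 `DressedWindowSchedule`, S3
`DressedUniformConstants`, S3b `DressedTransportUniform`) ONLY; modifies nothing.

WHAT THIS FILE DOES.  Row S3d's per-cutoff face `bookingLeaves_ratio_of_schedule` is built on the ratio-END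
`transportLeaf_assembled_ratio` (S2c), which still DISPLAYS the Assembly's three bookkeeping EQUALITIES — the fresh budget
`hs1 : s1 b k = ‖c b k‖·Σ_{p ∈ Sg k b} 4·Asz p.1 p.2 k ∕ rs p.2 k · δf b k p` and the carried-size recursion `hAsz_birth` ∕
`hAsz_step` — as hypotheses on free data `s1`, `Asz`.  Leaf-01's FINAL FORM `transportLeaf_assembled_canonical_ratio` (S2d) has
none of them: sizes, budgets and slice radii are the canonical `aszOf` ∕ `s1Of` ∕ `rsOf r ϱ` of `DressedTransportAssembledData`,
defined by one joint ℕ-recursion, and the equalities are theorems.  This file puts the final form UNDER A WINDOW SCHEDULE: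

* §0 `rsOf_eq_sliceR` — along a step-indexed schedule the canonical slice radius `rsOf r (fun _ _ k => W.ϱc k)` IS row S1's
  `WindowSchedule.sliceR` (`r` at birth, the chart radius granted at the previous step afterwards).
* §1 **`transportLeaf_canonical_ratio_of_schedule`** — S2d's END with windows `𝒦 b k′ k := bondBall d (W.ρw k)`, fluctuation
  domains `D b k := bondBall d (W.σ k)`, diameters `θ b k := 2σ k`, chart radii `ϱ b k′ k := W.ϱc k`, margin radii
  `ϱ₁ b k := W.ϱ₁ k` READ OFF `W : WindowSchedule r w`, and the step-factor profile FIXED to the K-free constant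
  `α := fun _ => alphaCell κ` for a displayed ratio bound `hratio : ∀ k, 2σ k ≤ κ·ϱc k`: its FOURTEEN geometry ∕ radius ∕ (w4)
  binders `hα`, `hw`, `hD`, `hϱ`, `hϱ_birth`, `hϱ_succ`, `hmargin`, `hN1`, `hN2`, `hN1x`, `hN2cx`, `hdiam`, `hθ`, `hdom` are
  DISCHARGED by rows S1 ∕ S3b BY NAME (`hD_of_schedule` … `hN2cx_of_schedule`, `WindowSchedule.ϱc_lt_r` ∕ `ϱc_lt_ϱc` ∕
  `hϱc₁` ∕ `ϱ₁_pos` ∕ `ϱ₁_le_sliceR`, `hdom_of_ratioBound` ∕ `hα_of_ratioBound`).  What stays displayed is the wall ∕ dictionary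
  ONLY: (w1) `hsl`; H2 `hFn` ∕ `h𝒢` and the dictionary `hQ` ∕ `hSg` (NO `hs1`, NO `hAsz_birth`, NO `hAsz_step` — no `s1`, no `Asz`
  at all); (w2-act) `hB` ∕ `hE` (printed TYPE [Balaban1989LargeFieldII] (1.65) p. 375, (1.71)–(1.75) pp. 379–380 — asserted for
  Bałaban's densities NOWHERE); `hDμ` ∕ `hz₁`; (I4′) the booked link `hlink` (transverse fresh defect RELATIVE TO THE CURRENT SLICE
  RADIUS `W.sliceR k″ k`, source factor against budget factor — the (I4′) wall, displayed, not decided), `hδfw`, `hpairx`, `hdefw`,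
  `hrate`; attainment `hlin`; invariance `hinv`; measurability `hmeas`; scalars `hr` ∕ `hcδ` ∕ `hψ` ∕ `hm`; `hratio`.  Conclusion:
  VERBATIM the field type of `BookingLeaves.htr` with `C = 4c_δ∕r`, `ρ i = ψ·alphaCell κ`.
* §2 **`bookingLeaves_canonical_ratio_of_schedule`** : at the cell's transverse rate `ψ := L⁻²` (F-6's READING, caveat k3 — a
  parameter choice, load-bearing: `T4TrajectoryDensityFreshBudget.freshProfile_not_Kfree`), the bundle
  `BookingLeaves (uniformConstantsCell L (4c_δ∕r) c̄ κ N₀ A₀ m s̄⁰ ρ′ …) B T` — the per-cutoff input of END-B — with `htr` discharged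
  by §1 and (w7) `hρ` ∕ `hc` ∕ `hrate` by row S3 (`bookingLeavesCell`); displayed in addition: (w5) `hreg` with `0 ≤ creg k ≤ c̄`,
  (w2-act) `hs₀`, (w3-book) `hS` ∕ `hcount` at rate `L⁴` (row S4's instance supplies them), (w1)+(w5b) `hbirth` (row S5's suppliers),
  and row S3's located scalars `1 ≤ L`, `locCell L (4c_δ∕r) c̄ κ ≤ ρ′ < 1` ((w7)), `m·(N₀A₀(1−ρ′)⁻¹) ≤ 1 − s̄⁰` ((w6)).  This is the
  crew's per-cutoff face with the SHORTEST displayed list.  A ratio-bounded schedule without floor exists: row S3b's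
  `RatioGeometric.schedule` with `κ = 2` (`DressedTransportRatioScheduled.ratio_geometric`).

LOCATED CAVEATS CARRIED (not resolved here).  LF-1's FLOOR half is absent (no `r_*`); its WINDOW half stands: a `WindowSchedule r w`
consumes more than the uniform slice window `w` per met step (`WindowSchedule.window_budget`: `ρw K + K·w ≤ ρw 0`), so the (w1)
window `bondBall d (W.ρw k′)` displayed in `hsl` grows linearly with the cutoff — an all-cutoff face over §2 must index the schedule
by `(p, K)` (leaf-02's S3e pattern; the END-ALL over §2 is the same pointwise corollary and is NOT filed here).  LF-2 (leaf-04,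
F-ne1pleaf04-1): the uniform slice window `w` in `hN2cx` ∕ `hpairx` is what forces it for every ASSEMBLED leaf; the cure is the
per-step slice-window re-cut (row S1e «slice-win»), not this file.

HONEST FRAMING.  Kernel composition over hypothesis shapes ([folklore]; 0 sorry; 0 citations used as facts; the one `def` is a
`BookingLeaves`-valued TERM, no `def … : Prop`).  Headline: «BookingLeaves ∕ NE1′-per-cutoff ⇐ the DISPLAYED wall binders (no
Assembly equalities, no floor, no window geometry, no separate (w4)) + located largeness + a ratio-bounded window schedule», NEVER
«NE1′ proved»; 0 leaves instantiated on Bałaban's densities; the wall (w1), (w2-act) THE NUMBER, (w3)⁺ (incl. the window budget),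
(w5), (w6), (w7)'s located largeness, F-6's rate ∕ `hlink` stands; spine PROVED 0∕9.  Rung (B)+1 on ONE finite four-torus — NOT
infinite volume, NOT a mass gap, NOT OS on ℝ⁴, NOT Clay.  HONEST DEPENDENCY: continuum YM on T⁴ ⇐ BetaPertH ∧ nine spine
estimates (0/9 proved); BetaPertH ⇐ (D1) ∧ (D4) ∧ CAP+tail; G-an2-4 gates asym, D1 and NE2/3/4.
-/

noncomputable section

namespace Summit.QuantumFields.BalabanUV.T4Continuum.NE1p.DressedTransportCanonicalScheduled

open MeasureTheory Set Metric Finset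
open scoped BigOperators
open Literature.MathematicalPhysics.QuantumFieldTheory.Balaban1983to89
open Literature.MathematicalPhysics.QuantumFieldTheory.Balaban1983to89.T4TermFormat
open Literature.MathematicalPhysics.QuantumFieldTheory.Balaban1983to89.T4GatedBooking
open Literature.MathematicalPhysics.QuantumFieldTheory.Balaban1983to89.T4TrajectoryComparison
open Literature.MathematicalPhysics.QuantumFieldTheory.Balaban1983to89.T4TrajectoryModulus
open T4BirthChartTransport (GaugeInvariant BirthSlice RelGauge)
open T4BlockTransport (Fld NDir latMove latN)
open T4TrajectoryDensity
open Summit.QuantumFields.BalabanUV.T4Continuum.T4TrajectoryDensityDressed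
open Summit.QuantumFields.BalabanUV.T4Continuum.NE1p.DressedRoot
open Summit.QuantumFields.BalabanUV.T4Continuum.NE1p.DressedWindowSchedule
open Summit.QuantumFields.BalabanUV.T4Continuum.NE1p.DressedTransportAssembledData
open Summit.QuantumFields.BalabanUV.T4Continuum.NE1p.DressedTransportAssembledFinalForm
open Summit.QuantumFields.BalabanUV.T4Continuum.NE1p.DressedUniformConstants
open Summit.QuantumFields.BalabanUV.T4Continuum.NE1p.DressedTransportUniform
open Summit.QuantumFields.BalabanUV.T4Continuum.NE1p.DressedTransportRatioScheduled

/-! ## §0 The canonical slice radius along a schedule -/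

/-- **THE CANONICAL RADIUS IS THE SCHEDULE'S SLICE RADIUS** [arith]: with chart radii read off a step-indexed schedule,
`ϱ f k″ k := W.ϱc k`, the canonical slice radius `rsOf r ϱ f k″ k` of `DressedTransportAssembledData` (`r` for `k ≤ k″`,
`ϱ f k″ (k−1)` after) coincides with row S1's `W.sliceR k″ k` (`W.ϱc (k−1)` for `k″ < k`, `r` otherwise). [folklore] -/
theorem rsOf_eq_sliceR {r w : ℝ} (W : WindowSchedule r w) {B : T4TermFormat.Booking} (f : B.Birth) (k'' k : ℕ) :
    rsOf r (fun (_ : B.Birth) (_ k : ℕ) => W.ϱc k) f k'' k = W.sliceR k'' k := by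
  unfold rsOf WindowSchedule.sliceR
  by_cases h : k ≤ k''
  · rw [if_pos h, if_neg (not_lt.mpr h)]
  · rw [if_neg h, if_pos (not_le.mp h)]

/-! ## §1 The final-form END under a ratio-bounded window schedule -/

section FunctionLevel

variable {r w : ℝ} (W : WindowSchedule r w)
variable {B : T4TermFormat.Booking} {T : Trajectory B}
variable {R : Type*} [NormedRing R] [NormedAlgebra ℂ R] [MeasurableSpace R] {d : ℕ}

/-- **FINAL-FORM END UNDER A RATIO-BOUNDED WINDOW SCHEDULE — NO ASSEMBLY EQUALITIES, NO FLOOR, NO WINDOW GEOMETRY, NO (w4)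
BINDER** [bookkeeping]: leaf-01's `DressedTransportAssembledFinalForm.transportLeaf_assembled_canonical_ratio` with windows,
fluctuation domains, diameters, chart and margin radii READ OFF `W : WindowSchedule r w` (row S1's discharges `hD_of_schedule` …
`hN2cx_of_schedule` BY NAME; the schedule inequalities `hϱ_birth` ∕ `hϱ_succ` are `WindowSchedule.ϱc_lt_r` ∕ `ϱc_lt_ϱc`; `hmargin`
over the canonical radius by §0 and `ϱ₁_le_sliceR`) and the step-factor profile FIXED to the K-free constant `α := fun _ =>
alphaCell κ` for a displayed ratio bound `hratio : ∀ k, 2σ k ≤ κ·ϱc k` (row S3b's `hdom_of_ratioBound` ∕ `hα_of_ratioBound`).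
Displayed (wall ∕ dictionary only): (w1) `hsl`; H2 `hFn` ∕ `h𝒢` and the dictionary `hQ` ∕ `hSg`; (w2-act) `hB` ∕ `hE`; `hDμ` ∕ `hz₁`;
(I4′) the booked link `hlink` over the schedule's slice radius `W.sliceR k″ k`, `hδfw`, `hpairx`, `hdefw`, `hrate`; scalars
`hr` ∕ `hcδ` ∕ `hψ` ∕ `hm`; attainment `hlin`; invariance; measurability.  Conclusion: VERBATIM the field type of `BookingLeaves.htr`
with `C = 4c_δ∕r`, `ρ i = ψ·alphaCell κ`. [folklore] -/
theorem transportLeaf_canonical_ratio_of_schedule {κ : ℝ} {Fn : B.Birth → ℕ → ℕ → Fld d R → ℂ}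
    {rel : B.Birth → ℕ → ℕ → Fld d R → Fld d R → Prop}
    {ref : B.Birth → ℕ → Fld d R → Fld d R} {base : B.Birth → ℕ → Fld d R → ℝ}
    {𝒜 𝒬 : B.Birth → ℕ → Fld d R → Fld d R → ℂ} {q : B.Birth → ℕ → Fld d R → ℂ}
    {μ : B.Birth → ℕ → Measure (Fld d R)} {z₀ z₁ : B.Birth → ℕ → Fld d R}
    {defect : B.Birth → ℕ → ℕ → ℝ} {cδ ψ m : ℝ} {s : B.Birth → ℕ → ℝ}
    {S : ℕ → B.Birth → Finset B.Birth}
    {Sg : ℕ → B.Birth → Finset (B.Birth × ℕ)} {c : B.Birth → ℕ → ℂ} {δf : B.Birth → ℕ → B.Birth × ℕ → ℝ}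
    (hratio : ∀ k, 2 * W.σ k ≤ κ * W.ϱc k)
    (hr : 0 < r) (hcδ : 0 ≤ cδ) (hψ : 0 ≤ ψ) (hm : 0 ≤ m)
    (hsl : ∀ (b : B.Birth) (k' : ℕ), B.birthScale b ≤ k' → k' ≤ B.K →
      RanBelow (budgetGate T s m S (4 * cδ / r) (fun i => ψ * (fun _ : ℕ => alphaCell κ) i)) k' →
      BirthSlice (Fn b k' k') latMove latN (bondBall d (W.ρw k') : Set (Fld d R)) w r (T.gen b k'))
    (hFn : ∀ (b : B.Birth) (k' k : ℕ), B.birthScale b ≤ k' → k' ≤ k → k + 1 ≤ B.K →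
      RanBelow (budgetGate T s m S (4 * cδ / r) (fun i => ψ * (fun _ : ℕ => alphaCell κ) i)) (k + 1) →
      ∀ U, Fn b k' (k + 1) U =
        wOp (expWeight (base b k) (𝒜 b k + 𝒬 b k)) (μ b k) (z₀ b k) U (fun z => Fn b k' k (U + z)))
    (h𝒢 : ∀ (b : B.Birth) (k' k : ℕ), B.birthScale b ≤ k' → k' ≤ k → k + 1 ≤ B.K →
      RanBelow (budgetGate T s m S (4 * cδ / r) (fun i => ψ * (fun _ : ℕ => alphaCell κ) i)) (k + 1) →
      ∀ U, (fun z => Fn b k' k (U + z)) ∈ BddClass ℂ (μ b k))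
    (hB : ∀ (b : B.Birth) (k' k : ℕ), B.birthScale b ≤ k' → k' ≤ k → k + 1 ≤ B.K →
      RanBelow (budgetGate T s m S (4 * cδ / r) (fun i => ψ * (fun _ : ℕ => alphaCell κ) i)) (k + 1) →
      RealBaseAt (ref b k) (base b k) (𝒜 b k) (μ b k) (bondBall d (W.ρw (k + 1)) : Set (Fld d R)))
    (hE : ∀ (b : B.Birth) (k' k : ℕ), B.birthScale b ≤ k' → k' ≤ k → k + 1 ≤ B.K →
      RanBelow (budgetGate T s m S (4 * cδ / r) (fun i => ψ * (fun _ : ℕ => alphaCell κ) i)) (k + 1) →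
      ExponentSliceAt (ref b k) (𝒜 b k) (μ b k) latMove latN (bondBall d (W.ρw (k + 1)) : Set (Fld d R)) w (W.ϱc k)
        (s b k))
    (hQ : ∀ b k, (fun U z => 𝒬 b k U z - q b k U) =
      fun U z => c b k * ∑ p ∈ Sg k b, (Fn p.1 p.2 k (U + z) - Fn p.1 p.2 k (U + z₁ b k)))
    (hSg : ∀ k b, ∀ p ∈ Sg k b, p.1 ∈ S k b ∧ B.birthScale p.1 ≤ p.2 ∧ p.2 ≤ k)
    (hlink : ∀ b k, ∀ p ∈ Sg k b,
      0 ≤ δf b k p ∧ ‖c b k‖ * (δf b k p / W.sliceR p.2 k) ≤ m * (cδ / r) * ψ ^ (k - p.2))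
    (hδfw : ∀ b k, ∀ p ∈ Sg k b, δf b k p ≤ w)
    (hDμ : ∀ b k, ∀ᵐ z ∂μ b k, z ∈ (bondBall d (W.σ k) : Set (Fld d R)))
    (hz₁ : ∀ b k, z₁ b k ∈ (bondBall d (W.σ k) : Set (Fld d R)))
    (hpairx : ∀ (b : B.Birth) (k' k : ℕ), B.birthScale b ≤ k' → k' ≤ k →
      ∀ p ∈ Sg k b, ∀ U₀ ∈ (bondBall d (W.ρw (k + 1)) : Set (Fld d R)), ∀ pd : NDir d R, 0 < latN pd → latN pd ≤ w →
        ∀ᵐ z ∂μ b k, ∀ t ∈ tube (W.ϱ₁ k / latN pd),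
          RelGauge (rel p.1 p.2 k) latMove latN (latMove U₀ pd t + z₁ b k) (latMove U₀ pd t + z) (δf b k p))
    (hinv : ∀ b k' k, GaugeInvariant (rel b k' k) (Fn b k' k))
    (hmeas : ∀ (b f : B.Birth) (k'' k : ℕ) (U : Fld d R), AEStronglyMeasurable (fun z => Fn f k'' k (U + z)) (μ b k))
    (hdefw : ∀ b k' k, defect b k' k ≤ w)
    (hrate : ∀ (b : B.Birth) (k' k : ℕ), B.birthScale b ≤ k' → k' ≤ k → k ≤ B.K →
      defect b k' k ≤ cδ * ψ ^ (k - k'))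
    (hlin : ∀ (b : B.Birth) (k' k : ℕ), B.birthScale b ≤ k' → k' ≤ k → k ≤ B.K →
      RanBelow (budgetGate T s m S (4 * cδ / r) (fun i => ψ * (fun _ : ℕ => alphaCell κ) i)) k → ∀ ε > 0,
      ∃ U₀ ∈ (bondBall d (W.ρw k) : Set (Fld d R)), ∃ U₁ : Fld d R,
        RelGauge (rel b k' k) latMove latN U₀ U₁ (defect b k' k) ∧
        T.lin b k' k ≤ ‖Fn b k' k U₁ - Fn b k' k U₀‖ + ε) :
    T.TransportsFromVar (4 * cδ / r) (fun i => ψ * (fun _ : ℕ => alphaCell κ) i)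
      (budgetGate T s m S (4 * cδ / r) (fun i => ψ * (fun _ : ℕ => alphaCell κ) i)) := by
  -- the Assembly's margin binder over the canonical radius, from the schedule (§0 + `ϱ₁_le_sliceR`)
  have hmargin : ∀ (b : B.Birth) (k' k : ℕ), B.birthScale b ≤ k' → k' ≤ k →
      (fun (_ : B.Birth) (_ k : ℕ) => W.ϱc k) b k' k < (fun (_ : B.Birth) (k : ℕ) => W.ϱ₁ k) b k ∧
        0 < (fun (_ : B.Birth) (k : ℕ) => W.ϱ₁ k) b k ∧
        ∀ p ∈ Sg k b, (fun (_ : B.Birth) (k : ℕ) => W.ϱ₁ k) b k ≤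
          rsOf r (fun (_ : B.Birth) (_ k : ℕ) => W.ϱc k) p.1 p.2 k :=
    fun _ _ k _ _ => ⟨W.hϱc₁ k, W.ϱ₁_pos k, fun p _ => by rw [rsOf_eq_sliceR]; exact W.ϱ₁_le_sliceR p.2 k⟩
  -- the booked link over the canonical radius (§0)
  have hlink' : ∀ b k, ∀ p ∈ Sg k b, 0 ≤ δf b k p ∧
      ‖c b k‖ * (δf b k p / rsOf r (fun (_ : B.Birth) (_ k : ℕ) => W.ϱc k) p.1 p.2 k) ≤ m * (cδ / r) * ψ ^ (k - p.2) :=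
    fun b k p hp => by rw [rsOf_eq_sliceR]; exact hlink b k p hp
  exact transportLeaf_assembled_canonical_ratio (𝒦 := fun _ _ k => (bondBall d (W.ρw k) : Set (Fld d R)))
    (D := fun _ k => (bondBall d (W.σ k) : Set (Fld d R))) (θ := fun _ k => 2 * W.σ k) (ϱ := fun _ _ k => W.ϱc k)
    (ϱ₁ := fun _ k => W.ϱ₁ k)
    (hα_of_ratioBound W hratio) hr W.w_pos hcδ hψ hm hsl hFn h𝒢 (hD_of_schedule W) (hϱ_of_schedule W) hB hE hQ hSg
    (fun _ k'' _ => W.ϱc_lt_r k'') (fun _ _ k _ _ => W.ϱc_lt_ϱc k) hmargin hlink' hδfw hDμ (hN1_of_schedule W)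
    (hN2_of_schedule W) (hN1x_of_schedule W Sg) (hN2cx_of_schedule W Sg hz₁) hpairx (hdiam_of_schedule W) (hθ_of_schedule W)
    (fun _ _ k _ _ hk => hdom_of_ratioBound W hratio k hk) hinv hmeas hdefw hrate hlin

end FunctionLevel

/-! ## §2 The K-free per-cutoff face over canonical data: `BookingLeaves` over the uniform constants -/

section Bundle

variable {r w : ℝ} (W : WindowSchedule r w)
variable {B : T4TermFormat.Booking} {T : Trajectory B}
variable {R : Type*} [NormedRing R] [NormedAlgebra ℂ R] [MeasurableSpace R] {d : ℕ}

/-- **THE CREW'S PER-CUTOFF BUNDLE OVER CANONICAL DATA** [bookkeeping]: at the cell's transverse rate `ψ := L⁻²` (F-6's reading — a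
parameter choice) and the K-∕μ-free constants `U := uniformConstantsCell L (4c_δ∕r) c̄ κ N₀ A₀ m s̄⁰ ρ′` of row S3, the leaf binders
`BookingLeaves U B T` of END-B with T `htr` DISCHARGED by §1 (no Assembly equalities, no floor, no window geometry, no (w4) — a
ratio-bounded schedule instead) and (w7) `hrate` ∕ `hρ` ∕ `hc` DISCHARGED by row S3 (`bookingLeavesCell`).  DISPLAYED, per cutoff:
§1's wall ∕ dictionary binders (incl. the (I4′) link `hlink` and the ratio `hratio`); (w5) `hreg` with `0 ≤ creg k ≤ c̄`; (w2-act)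
`hs₀ : s b k ≤ s̄⁰`; (w3-book) `hS` ∕ `hcount` at rate `L⁴` (row S4's instance); (w1)+(w5b) `hbirth` in the class
`twoRate A₀ (rhoOne L⁻² (4c_δ∕r) c̄ κ) L⁻³ K` (row S5's suppliers); row S3's located scalars `1 ≤ L`, `locCell L (4c_δ∕r) c̄ κ ≤ ρ′ < 1`
((w7)), `m·(N₀A₀(1−ρ′)⁻¹) ≤ 1 − s̄⁰` ((w6)).  The schedule's window budget (`ρw K + K·w ≤ ρw 0`, LF-1's window half) stays
inside `hsl`'s window `bondBall d (ρw k′)`.  Feed `∀ p K` of it to END-B (`dressedStability_of_cell`).  Nothing of Bałaban's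
densities asserted. [folklore] -/
def bookingLeaves_canonical_ratio_of_schedule {κ L cbar N₀ A₀ sbar ρ' : ℝ} {Fn : B.Birth → ℕ → ℕ → Fld d R → ℂ}
    {rel : B.Birth → ℕ → ℕ → Fld d R → Fld d R → Prop}
    {ref : B.Birth → ℕ → Fld d R → Fld d R} {base : B.Birth → ℕ → Fld d R → ℝ}
    {𝒜 𝒬 : B.Birth → ℕ → Fld d R → Fld d R → ℂ} {q : B.Birth → ℕ → Fld d R → ℂ}
    {μ : B.Birth → ℕ → Measure (Fld d R)} {z₀ z₁ : B.Birth → ℕ → Fld d R}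
    {defect : B.Birth → ℕ → ℕ → ℝ} {cδ m : ℝ} {s : B.Birth → ℕ → ℝ}
    {S : ℕ → B.Birth → Finset B.Birth}
    {Sg : ℕ → B.Birth → Finset (B.Birth × ℕ)} {c : B.Birth → ℕ → ℂ} {δf : B.Birth → ℕ → B.Birth × ℕ → ℝ}
    {creg : ℕ → ℝ}
    -- the schedule's K-free diameter∕radius ratio
    (hratio : ∀ k, 2 * W.σ k ≤ κ * W.ϱc k)
    -- row S3's located scalars ((w7) largeness, (w6) window) and signs
    (hL : 1 ≤ L) (hcbar : 0 ≤ cbar) (hN₀ : 0 ≤ N₀) (hA₀ : 0 ≤ A₀) (hm : 0 ≤ m)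
    (hloc : locCell L (4 * cδ / r) cbar κ ≤ ρ') (hρ'1 : ρ' < 1)
    (hsmall : m * (N₀ * A₀ * (1 - ρ')⁻¹) ≤ 1 - sbar)
    -- scalars of the END
    (hr : 0 < r) (hcδ : 0 ≤ cδ)
    -- the END's wall ∕ dictionary binders at ψ := L⁻²
    (hsl : ∀ (b : B.Birth) (k' : ℕ), B.birthScale b ≤ k' → k' ≤ B.K →
      RanBelow (budgetGate T s m S (4 * cδ / r) (fun i => (L ^ 2)⁻¹ * (fun _ : ℕ => alphaCell κ) i)) k' →
      BirthSlice (Fn b k' k') latMove latN (bondBall d (W.ρw k') : Set (Fld d R)) w r (T.gen b k'))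
    (hFn : ∀ (b : B.Birth) (k' k : ℕ), B.birthScale b ≤ k' → k' ≤ k → k + 1 ≤ B.K →
      RanBelow (budgetGate T s m S (4 * cδ / r) (fun i => (L ^ 2)⁻¹ * (fun _ : ℕ => alphaCell κ) i)) (k + 1) →
      ∀ U, Fn b k' (k + 1) U =
        wOp (expWeight (base b k) (𝒜 b k + 𝒬 b k)) (μ b k) (z₀ b k) U (fun z => Fn b k' k (U + z)))
    (h𝒢 : ∀ (b : B.Birth) (k' k : ℕ), B.birthScale b ≤ k' → k' ≤ k → k + 1 ≤ B.K →
      RanBelow (budgetGate T s m S (4 * cδ / r) (fun i => (L ^ 2)⁻¹ * (fun _ : ℕ => alphaCell κ) i)) (k + 1) →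
      ∀ U, (fun z => Fn b k' k (U + z)) ∈ BddClass ℂ (μ b k))
    (hB : ∀ (b : B.Birth) (k' k : ℕ), B.birthScale b ≤ k' → k' ≤ k → k + 1 ≤ B.K →
      RanBelow (budgetGate T s m S (4 * cδ / r) (fun i => (L ^ 2)⁻¹ * (fun _ : ℕ => alphaCell κ) i)) (k + 1) →
      RealBaseAt (ref b k) (base b k) (𝒜 b k) (μ b k) (bondBall d (W.ρw (k + 1)) : Set (Fld d R)))
    (hE : ∀ (b : B.Birth) (k' k : ℕ), B.birthScale b ≤ k' → k' ≤ k → k + 1 ≤ B.K →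
      RanBelow (budgetGate T s m S (4 * cδ / r) (fun i => (L ^ 2)⁻¹ * (fun _ : ℕ => alphaCell κ) i)) (k + 1) →
      ExponentSliceAt (ref b k) (𝒜 b k) (μ b k) latMove latN (bondBall d (W.ρw (k + 1)) : Set (Fld d R)) w (W.ϱc k)
        (s b k))
    (hQ : ∀ b k, (fun U z => 𝒬 b k U z - q b k U) =
      fun U z => c b k * ∑ p ∈ Sg k b, (Fn p.1 p.2 k (U + z) - Fn p.1 p.2 k (U + z₁ b k)))
    (hSg : ∀ k b, ∀ p ∈ Sg k b, p.1 ∈ S k b ∧ B.birthScale p.1 ≤ p.2 ∧ p.2 ≤ k)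
    (hlink : ∀ b k, ∀ p ∈ Sg k b,
      0 ≤ δf b k p ∧ ‖c b k‖ * (δf b k p / W.sliceR p.2 k) ≤ m * (cδ / r) * ((L ^ 2)⁻¹) ^ (k - p.2))
    (hδfw : ∀ b k, ∀ p ∈ Sg k b, δf b k p ≤ w)
    (hDμ : ∀ b k, ∀ᵐ z ∂μ b k, z ∈ (bondBall d (W.σ k) : Set (Fld d R)))
    (hz₁ : ∀ b k, z₁ b k ∈ (bondBall d (W.σ k) : Set (Fld d R)))
    (hpairx : ∀ (b : B.Birth) (k' k : ℕ), B.birthScale b ≤ k' → k' ≤ k →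
      ∀ p ∈ Sg k b, ∀ U₀ ∈ (bondBall d (W.ρw (k + 1)) : Set (Fld d R)), ∀ pd : NDir d R, 0 < latN pd → latN pd ≤ w →
        ∀ᵐ z ∂μ b k, ∀ t ∈ tube (W.ϱ₁ k / latN pd),
          RelGauge (rel p.1 p.2 k) latMove latN (latMove U₀ pd t + z₁ b k) (latMove U₀ pd t + z) (δf b k p))
    (hinv : ∀ b k' k, GaugeInvariant (rel b k' k) (Fn b k' k))
    (hmeas : ∀ (b f : B.Birth) (k'' k : ℕ) (U : Fld d R), AEStronglyMeasurable (fun z => Fn f k'' k (U + z)) (μ b k))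
    (hdefw : ∀ b k' k, defect b k' k ≤ w)
    (hrate : ∀ (b : B.Birth) (k' k : ℕ), B.birthScale b ≤ k' → k' ≤ k → k ≤ B.K →
      defect b k' k ≤ cδ * ((L ^ 2)⁻¹) ^ (k - k'))
    (hlin : ∀ (b : B.Birth) (k' k : ℕ), B.birthScale b ≤ k' → k' ≤ k → k ≤ B.K →
      RanBelow (budgetGate T s m S (4 * cδ / r) (fun i => (L ^ 2)⁻¹ * (fun _ : ℕ => alphaCell κ) i)) k →
      ∀ ε > 0, ∃ U₀ ∈ (bondBall d (W.ρw k) : Set (Fld d R)), ∃ U₁ : Fld d R,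
        RelGauge (rel b k' k) latMove latN U₀ U₁ (defect b k' k) ∧
        T.lin b k' k ≤ ‖Fn b k' k U₁ - Fn b k' k U₀‖ + ε)
    -- the booking-level wall binders: (w5) regeneration, (w2-act) margin, (w3-book) counts, (w1)+(w5b) births
    (hc0 : ∀ k, 0 ≤ creg k) (hcb : ∀ k, k < B.K → creg k ≤ cbar)
    (hreg : T.RegeneratesFromVar creg
      (budgetGate T s m S (4 * cδ / r) (fun _ : ℕ => (L ^ 2)⁻¹ * alphaCell κ)))
    (hs₀ : ∀ b k, s b k ≤ sbar)
    (hS : ∀ k b, ∀ f ∈ S k b, B.birthScale f ≤ k)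
    (hcount : ∀ k b, ∀ j ≤ k, (((S k b).filter fun f => B.birthScale f = j).card : ℝ) ≤ N₀ * (L ^ 4) ^ (k - j))
    (hbirth : T.BirthsFromOld (4 * cδ / r) (fun _ : ℕ => (L ^ 2)⁻¹ * alphaCell κ)
      (twoRate A₀ (rhoOne (L ^ 2)⁻¹ (4 * cδ / r) cbar κ) (L⁻¹ ^ 3) B.K)
      (budgetGate T s m S (4 * cδ / r) (fun _ : ℕ => (L ^ 2)⁻¹ * alphaCell κ))) :
    BookingLeaves (uniformConstantsCell L (4 * cδ / r) cbar κ N₀ A₀ m sbar ρ' hL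
      (div_nonneg (mul_nonneg (by norm_num) hcδ) hr.le) hcbar (ratio_κ_nonneg W hratio) hN₀ hA₀ hm hloc hρ'1 hsmall) B T :=
  bookingLeavesCell hL (div_nonneg (mul_nonneg (by norm_num) hcδ) hr.le) hcbar (ratio_κ_nonneg W hratio) hN₀ hA₀ hm hloc hρ'1
    hsmall creg s S hc0 hcb hS hcount hs₀ hbirth
    (transportLeaf_canonical_ratio_of_schedule W hratio hr hcδ (inv_nonneg.mpr (sq_nonneg L)) hm hsl hFn h𝒢 hB hE hQ hSg
      hlink hδfw hDμ hz₁ hpairx hinv hmeas hdefw hrate hlin)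
    hreg

end Bundle

end Summit.QuantumFields.BalabanUV.T4Continuum.NE1p.DressedTransportCanonicalScheduled

end
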